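import Summits.NavierStokesRegularity.NavierStokesRegularity.Theses.AxisymmetricExtremality
import Summits.NavierStokesRegularity.NavierStokesRegularity.Theorems.AxisymmetricExtremalityAxisymmetricKatoGlobalStubSeregin2020TypeIINoSwirlCoreCutoffRadii
import Literature.Analysis.FluidPDE.NSVorticityOfSmoothRepresentative
import Literature.Analysis.FluidPDE.SereginZajaczkowski2007
import HarnessLib

/-!
# Seregin 2020, proof of Thm 2.1, the no-swirl endgame core: the classical vorticity equation
# of the smooth swirl-free representative, packaged for the `η = ω_θ/ϱ` maximum principle

Helper toward the stub `stub_seregin2020TypeII` of the crux `AxisymmetricKatoGlobal` (= the named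
fact `Literature.Analysis.FluidPDE.Seregin2020_axisymmetricSingularPoint_typeII`, G. Seregin,
Anal. Math. Phys. 10 (2020) Paper 46 = arXiv:2006.04140, Thm 2.1), last paragraph of the
printed proof (arXiv p. 8: "by considering a problem for `η = ω_φ/ϱ` … reduction of it to
spatial dimension 5"). The tree's local maximum principle for `η`
(`Literature.Analysis.FluidPDE.noSwirl_abs_scalar_le_of_boundary`) wants, besides the regularity
of the globally smooth axisymmetric swirl-free family `W τ` (sibling file
`…NoSwirlCoreCutoffRadii`: `W = χ • V`, `χ = radialCutoff ρ₁ ρ₂ (· - c)`), the classical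
time-integrated VORTICITY equation on a ball (`hvort`, `hvortc`).
This file derives it for the Seregin–Zajaczkowski 2007 class `IsSmoothAxisymmetricSolutionOn S V p`
(the class of the smooth representative of the swirl-free blow-up limit on an open set of
regular points, sibling file `…NoSwirlRegularRepr`) on a product `I × B(c, ρ₃) ⊆ S`:

* `vorticity_hasDerivAt_of_isSmoothAxisymmetricSolutionOn` — the CLASSICAL vorticity equation
  `∂ₜω = Δω - Dω[V] + DV[ω]` at every point of a product `I × U ⊆ S` with a jointly continuous
  right-hand side (the tree's `vorticity_classical_of_isDistributionalNSSolutionOn`: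
  pressure-free testing with curls and du Bois-Reymond in time — no time regularity of `V` or
  `p` is needed, which is the point: across the singular top time the pressure is not
  controlled);
* `cutoffField_vorticity_package` — the hypotheses `hsmooth`, `hunif`, `hax`, `hsw`, `hvort`,
  `hvortc` of `noSwirl_abs_scalar_le_of_boundary` for `W = χ • V` on the ball `B(c, ρ₁)`.

## References

* G. Seregin, Anal. Math. Phys. 10 (2020), Paper 46 = arXiv:2006.04140, proof of Thm. 2.1, last
  paragraph (arXiv p. 8). [Seregin2020]
* P. G. Lemarié-Rieusset, *The Navier–Stokes Problem in the 21st Century* (2016), Thm. 13.1,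
  proof Step 1 (p. 436) (the vorticity equation of a distributional solution). [LemarieRieusset2016]
-/

-- the problem directory repeats the summit name (D-0017); core's `dupNamespace` linter fires
set_option linter.dupNamespace false

noncomputable section

open MeasureTheory Set Function Filter Topology TopologicalSpace Metric
open scoped NNReal ENNReal ContDiff Laplacian

namespace Summit.NavierStokesRegularity.NavierStokesRegularity.Theorems.AxisymmetricKatoGlobal.EulerScaling

open Literature.Analysis.FluidPDE Literature.Analysis.FluidPDE.SereginZajaczkowski2007

/-! ### The classical vorticity equation of the class, and the package -/

section Vorticity

variable {S : Opens (ℝ × EuclideanSpace ℝ (Fin 3))}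
  {V : ℝ → EuclideanSpace ℝ (Fin 3) → EuclideanSpace ℝ (Fin 3)}
  {p : ℝ → EuclideanSpace ℝ (Fin 3) → ℝ} {I : Set ℝ}

/-- **The classical vorticity equation of a "sufficiently smooth axially symmetric solution" on
a product region.** If `(V, p)` is in the Seregin–Zajaczkowski class on an open `S` containing
the product `I × U` of an open time set and an open space set, then at every `(t, x) ∈ I × U`
`div V = 0`, the time line `s ↦ curl (V s) x` is differentiable at `t` with derivative
`Δ(curl V t) x - D(curl V t)(x)[V t x] + D(V t)(x)[curl V t x]`, and this right-hand side is
jointly continuous on `I × U` (it is the time partial of the jointly `C¹` vorticity). The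
tree's `vorticity_classical_of_isDistributionalNSSolutionOn` (distributional equations, `C³`
slices, jointly continuous `D_xⁿV`, `n ≤ 3` — all supplied by the class).
[cite: LemarieRieusset2016, Thm. 13.1 proof Step 1 (p. 436) and proof of Thm. 15.4, Step 3 ¶1 (PDF p. 569)] -/
theorem vorticity_hasDerivAt_of_isSmoothAxisymmetricSolutionOn
    (hV : IsSmoothAxisymmetricSolutionOn S V p) (hI : IsOpen I)
    {U : Set (EuclideanSpace ℝ (Fin 3))} (hU : IsOpen U)
    (hsub : I ×ˢ U ⊆ (S : Set (ℝ × EuclideanSpace ℝ (Fin 3)))) :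
    (∀ w ∈ I ×ˢ U, VectorCalculus.divergence (V w.1) w.2 = 0) ∧
    (∀ t ∈ I, ∀ x ∈ U, HasDerivAt (fun s => curl (V s) x)
      ((Δ (curl (V t))) x - fderiv ℝ (curl (V t)) x (V t x) +
        fderiv ℝ (V t) x (curl (V t) x)) t) ∧
    ContinuousOn (fun w : ℝ × EuclideanSpace ℝ (Fin 3) =>
      (Δ (curl (V w.1))) w.2 - fderiv ℝ (curl (V w.1)) w.2 (V w.1 w.2) +
        fderiv ℝ (V w.1) w.2 (curl (V w.1) w.2)) (I ×ˢ U) := by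
  have hO : IsOpen (I ×ˢ U) := hI.prod hU
  have hle : (⟨I ×ˢ U, hO⟩ : Opens (ℝ × EuclideanSpace ℝ (Fin 3))) ≤ S := hsub
  have hsol : IsDistributionalNSSolutionOn ⟨I ×ˢ U, hO⟩ 1 0 V p :=
    hV.suitable.distributional.of_le hle
  have hU3 : ∀ t ∈ I, ContDiffOn ℝ 3 (V t) U := fun t ht x hx =>
    ((hV.contDiffAt (t, x) (hsub ⟨ht, hx⟩)).of_le (by norm_cast)).contDiffWithinAt
  have hΦ : ∀ n ≤ 3, ContinuousOn
      (fun w : ℝ × EuclideanSpace ℝ (Fin 3) => iteratedFDeriv ℝ n (V w.1) w.2) (I ×ˢ U) :=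
    fun n _ => (hV.continuousOn_iteratedFDeriv n).mono hsub
  obtain ⟨hdiv, -, hder, htd, hC1⟩ :=
    vorticity_classical_of_isDistributionalNSSolutionOn hI hU hsol hU3 hΦ
  have hder' : ∀ t ∈ I, ∀ x ∈ U, HasDerivAt (fun s => curl (V s) x)
      ((Δ (curl (V t))) x - fderiv ℝ (curl (V t)) x (V t x) +
        fderiv ℝ (V t) x (curl (V t) x)) t := fun t ht x hx => by
    simpa only [vorticity_apply, convect_apply, one_smul] using hder t ht x hx
  refine ⟨hdiv, hder', ?_⟩
  -- the right-hand side is the time partial of the jointly `C¹` vorticity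
  have hDc : ContinuousOn (fun w : ℝ × EuclideanSpace ℝ (Fin 3) =>
      fderiv ℝ (uncurry (vorticity V)) w ((1 : ℝ), (0 : EuclideanSpace ℝ (Fin 3)))) (I ×ˢ U) :=
    (hC1.continuousOn_fderiv_of_isOpen hO le_rfl).clm_apply continuousOn_const
  refine hDc.congr fun w hw => ?_
  have hd : DifferentiableAt ℝ (uncurry (vorticity V)) w :=
    (hC1.differentiableOn one_ne_zero).differentiableAt (hO.mem_nhds hw)
  have hline : HasDerivAt (fun s : ℝ => ((s, w.2) : ℝ × EuclideanSpace ℝ (Fin 3)))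
      ((1 : ℝ), (0 : EuclideanSpace ℝ (Fin 3))) w.1 :=
    (hasDerivAt_id w.1).prodMk (hasDerivAt_const w.1 w.2)
  have hcomp : HasDerivAt (fun s : ℝ => curl (V s) w.2)
      (fderiv ℝ (uncurry (vorticity V)) w ((1 : ℝ), (0 : EuclideanSpace ℝ (Fin 3)))) w.1 := by
    have h := hd.hasFDerivAt.comp_hasDerivAt w.1 hline
    simpa [Function.comp_def, uncurry, vorticity_apply] using h
  exact (hcomp.unique (hder' w.1 hw.1 w.2 hw.2)).symm

/-- **The package: the cut-off representative satisfies the hypotheses of the `η`-maximum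
principle.** Let `(V, p)` be in the Seregin–Zajaczkowski class on an open `S ⊇ I × B(c, ρ₃)`
(`I` an open interval, `c` on the axis, `0 < ρ₁ < ρ₂ < ρ₃`) with `swirl (V t) x = 0` at the
points of `I × B(c, ρ₃)`, and `W τ = χ • V τ`, `χ = radialCutoff ρ₁ ρ₂ (· - c)`. Then `W` has
smooth, axisymmetric, swirl-free slices with uniform-in-`x` time moduli of all `x`-derivatives
on `I`, and satisfies the classical time-integrated vorticity equation, with an integrand
continuous in time, at the points of `B(c, ρ₁)` — the hypotheses `hsmooth`, `hunif`, `hax`,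
`hsw`, `hvort`, `hvortc` of `noSwirl_abs_scalar_le_of_boundary`.
[cite: Seregin2020, proof of Thm. 2.1, last paragraph (arXiv p. 8)] -/
theorem cutoffField_vorticity_package :
    ∀ (S : Opens (ℝ × EuclideanSpace ℝ (Fin 3)))
      (V : ℝ → EuclideanSpace ℝ (Fin 3) → EuclideanSpace ℝ (Fin 3))
      (p : ℝ → EuclideanSpace ℝ (Fin 3) → ℝ) (I : Set ℝ) (c : EuclideanSpace ℝ (Fin 3))
      (ρ₁ ρ₂ ρ₃ : ℝ) (W : ℝ → EuclideanSpace ℝ (Fin 3) → EuclideanSpace ℝ (Fin 3)),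
      IsSmoothAxisymmetricSolutionOn S V p → IsOpen I → I.OrdConnected → c 0 = 0 ∧ c 1 = 0 →
      0 < ρ₁ → ρ₁ < ρ₂ → ρ₂ < ρ₃ → I ×ˢ ball c ρ₃ ⊆ (S : Set (ℝ × EuclideanSpace ℝ (Fin 3))) →
      (∀ t ∈ I, ∀ y ∈ ball c ρ₃, swirl (V t) y = 0) →
      (∀ τ, W τ = fun y => radialCutoff ρ₁ ρ₂ (y - c) • V τ y) →
      (∀ τ ∈ I, ContDiff ℝ (⊤ : ℕ∞) (W τ)) ∧
      (∀ k : ℕ, ∀ τ ∈ I, ∀ ε > 0, ∃ δ > 0, ∀ τ' ∈ I, |τ' - τ| < δ → ∀ y,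
        ‖iteratedFDeriv ℝ k (W τ') y - iteratedFDeriv ℝ k (W τ) y‖ ≤ ε) ∧
      (∀ τ ∈ I, IsAxisymmetric (W τ)) ∧ (∀ τ ∈ I, HasNoSwirl (W τ)) ∧
      (∀ x ∈ ball c ρ₁, ∀ s ∈ I, ∀ t ∈ I, s ≤ t →
        curl (W t) x - curl (W s) x =
          ∫ τ in s..t, ((Δ (curl (W τ))) x - fderiv ℝ (curl (W τ)) x (W τ x) +
            fderiv ℝ (W τ) x (curl (W τ) x))) ∧
      (∀ x ∈ ball c ρ₁, ContinuousOn (fun τ => (Δ (curl (W τ))) x -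
        fderiv ℝ (curl (W τ)) x (W τ x) + fderiv ℝ (W τ) x (curl (W τ) x)) I) := by
  intro S V p I c ρ₁ ρ₂ ρ₃ W hV hI hIc hc h₁ h₁₂ h₂₃ hsub hV0 hW
  have hVs : ∀ τ ∈ I, ∀ y ∈ ball c ρ₃, ContDiffAt ℝ ∞ (V τ) y := fun τ hτ y hy =>
    hV.contDiffAt (τ, y) (hsub ⟨hτ, hy⟩)
  have hVc : ∀ n : ℕ, ContinuousOn
      (fun w : ℝ × EuclideanSpace ℝ (Fin 3) => iteratedFDeriv ℝ n (V w.1) w.2)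
      (I ×ˢ ball c ρ₃) := fun n => (hV.continuousOn_iteratedFDeriv n).mono hsub
  obtain ⟨-, hder, hgc⟩ :=
    vorticity_hasDerivAt_of_isSmoothAxisymmetricSolutionOn hV hI isOpen_ball hsub
  -- the local quantities of `W` at the points of `B(c, ρ₁)` are those of `V`
  have hloc : ∀ τ : ℝ, ∀ x ∈ ball c ρ₁, W τ x = V τ x ∧ curl (W τ) x = curl (V τ) x ∧
      (Δ (curl (W τ))) x - fderiv ℝ (curl (W τ)) x (W τ x) + fderiv ℝ (W τ) x (curl (W τ) x) =
      (Δ (curl (V τ))) x - fderiv ℝ (curl (V τ)) x (V τ x) +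
        fderiv ℝ (V τ) x (curl (V τ) x) := fun τ x hx => by
    obtain ⟨h0, h1, h2, h3, h4, -⟩ := radialCutoffField_local (V := V) h₁ h₁₂ τ hx
    rw [hW τ, h4, h3, h0, h1, h2]
    exact ⟨rfl, rfl, rfl⟩
  have hballs : ball c ρ₁ ⊆ ball c ρ₃ := ball_subset_ball (by linarith)
  refine ⟨fun τ hτ => ?_, fun k => ?_, fun τ hτ => ?_, fun τ hτ => ?_,
    fun x hx s hs t ht hst => ?_, fun x hx => ?_⟩
  · rw [hW τ]; exact radialCutoffField_contDiff h₁ h₁₂ h₂₃ (hVs τ hτ)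
  · simp_rw [hW]; exact unifTime_radialCutoffField V c ρ₁ ρ₂ ρ₃ I hI h₁ h₁₂ h₂₃ hVs hVc k
  · rw [hW τ]
    exact radialCutoffField_isAxisymmetric hc h₁ h₁₂ h₂₃ fun θ y hy =>
      hV.axisymmetric θ (τ, y) (hsub ⟨hτ, hy⟩)
  · rw [hW τ]; exact radialCutoffField_hasNoSwirl h₁ h₁₂ h₂₃ (hV0 τ hτ)
  · -- the time-integrated equation: fundamental theorem of calculus
    have hxU : x ∈ ball c ρ₃ := hballs hx
    rw [(hloc t x hx).2.1, (hloc s x hx).2.1,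
      intervalIntegral.integral_congr fun τ _ => (hloc τ x hx).2.2]
    have hstI : Icc s t ⊆ I := hIc.out hs ht
    have hcont : ContinuousOn (fun τ => (Δ (curl (V τ))) x - fderiv ℝ (curl (V τ)) x (V τ x) +
        fderiv ℝ (V τ) x (curl (V τ) x)) (Icc s t) := by
      have hm : MapsTo (fun τ : ℝ => ((τ, x) : ℝ × EuclideanSpace ℝ (Fin 3))) (Icc s t)
          (I ×ˢ ball c ρ₃) := fun τ hτ => ⟨hstI hτ, hxU⟩
      have h2 := hgc.comp (Continuous.prodMk_left x).continuousOn hm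
      exact h2.congr fun τ _ => rfl
    symm
    refine intervalIntegral.integral_eq_sub_of_hasDerivAt (f := fun τ => curl (V τ) x)
      (fun τ hτ => ?_) (hcont.intervalIntegrable_of_Icc hst)
    rw [uIcc_of_le hst] at hτ
    exact hder τ (hstI hτ) x hxU
  · -- continuity in time of the integrand
    have hxU : x ∈ ball c ρ₃ := hballs hx
    have hm : MapsTo (fun τ : ℝ => ((τ, x) : ℝ × EuclideanSpace ℝ (Fin 3))) I
        (I ×ˢ ball c ρ₃) := fun τ hτ => ⟨hτ, hxU⟩
    have h2 := hgc.comp (Continuous.prodMk_left x).continuousOn hm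
    exact h2.congr fun τ _ => (hloc τ x hx).2.2

end Vorticity

end Summit.NavierStokesRegularity.NavierStokesRegularity.Theorems.AxisymmetricKatoGlobal.EulerScaling

end
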